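import Mathlib
import Summits.KontsevichZagierPeriods.Zeta5Search.RecordCellAAtlasNotMin
import Summits.KontsevichZagierPeriods.Zeta5Search.SmallPrimeDominance
import Summits.KontsevichZagierPeriods.Zeta5Search.CasoratianClassBoundProof
import HarnessLib

/-!
# ζ(5) search — RECORD WINDOW `(15n, 16n)`: the class bound is `−3`, so `v_p(Cas₇(b(n))) ≥ −3` BY NAME (law M)

Cell `pub-zeta5` (HONEST FRAMING: systematic search; no irrationality claim unless certified), prover seat p3,
generation 5.  On the Brown–Zudilin record ray `b(n) = n·(41;17,16,15,14,13,12,11)` and a prime `15n < p < 16n` the census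
by-name LETTERS column beats both the kernel's `(WV)`-law window `(15n,16n]³` and Zudilin's bricks (`2c = 2`) by one unit:
the landed THEOREM LB (`ClusterValuation.casoratianClassBound_holds`: `casLB(b,p) ≤ v_p(Cas_j(b))`) with
**`casLB(b(n), p) ≥ −3`** there (census KERNEL-LEDGER §4, row `(15,17]`, letter `M`, 1.000 nats/step).  This file proves the
class-structure fact scale-free (all `n ≥ 1`), in the frame of P1 g5's record-cell-A atlas (`CellA.dep7`, `netExp_bRec`):
every residue class `{x, x+p(, x+2p)}` has `ν_x ≥ −3`, and every multipole class has `E_x ≥ −3` —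

* `x < 11n`: a zero `x` below the single pole `x + p ∈ (15n, 27n)` (and a zero `x + 2p > 30n` if present): TAME, `ν_x ≥ 0`,
  exactly one pole (`R0`);
* `11n ≤ x < 16n`: two points, `E_x = netExp(x) + netExp(x+p) ≥ −j + (j − 3) = −3` on `x ∈ [(11+j)n, (12+j)n)` (`R1`–`R5`);

hence `casLB ≥ −3 + 0` (`ClusterValuation.casLB_ge_or_noPole`), and **`recordCell1516`: `v_p(Cas₇(b(n))) ≥ −3` for every `n ≥ 1`
and prime `15n < p < 16n`** — consumed by the record-ray kernel atlas (`cell_core`: exponent `9 + 2·(−1) − 3 = 4` on the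
window, was `3`).  Valuations of rational numbers; nothing about irrationality.
-/

open Finset

namespace Summit.KontsevichZagierPeriods.Zeta5Search.Cell1516

open Summit.KontsevichZagierPeriods.Zeta5Search.ClusterValuation
open Summit.KontsevichZagierPeriods.Zeta5Search.CasoratianValuation (shift casoratian)
open Summit.KontsevichZagierPeriods.Zeta5Search.CellA

/-! ### §1 The classes when `3p > 41n` -/

/-- **The class of `x < p` for `41n/3 < p ≤ 41n/2`**: `{x, x+p, x+2p}` if `x + 2p ≤ 41n`, else `{x, x+p}` (the statement
of `CellA.classSet_bRec`, which is the case `14n < p < 15n`, under the weaker hypotheses its proof uses). -/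
theorem classSet_bRec_three {n p x : ℕ} (h3p : 41 * n < 3 * p) (h2p : 2 * p ≤ 41 * n) (hx : x < p) :
    classSet (bRec n) p x = if x + 2 * p ≤ 41 * n then {x, x + p, x + 2 * p} else {x, x + p} := by
  ext s
  rw [mem_classSet_iff, bRec_zero_toNat]
  have key : (s ≤ 41 * n ∧ (p : ℤ) ∣ (s : ℤ) - x) ↔ (s = x ∨ s = x + p ∨ (s = x + 2 * p ∧ x + 2 * p ≤ 41 * n)) := by
    constructor
    · rintro ⟨hs, k, hk⟩
      have hk0 : 0 ≤ k := by
        by_contra hneg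
        push Not at hneg
        have : (p : ℤ) * k ≤ (p : ℤ) * (-1) := mul_le_mul_of_nonneg_left (by omega) (by omega)
        omega
      have hk3 : k < 3 := by
        by_contra hge
        push Not at hge
        have : (p : ℤ) * 3 ≤ (p : ℤ) * k := mul_le_mul_of_nonneg_left hge (by omega)
        omega
      interval_cases k <;> omega
    · rintro (rfl | rfl | ⟨rfl, h⟩)
      · exact ⟨by omega, 0, by ring⟩
      · exact ⟨by omega, 1, by push_cast; ring⟩
      · exact ⟨h, 2, by push_cast; ring⟩
  rw [key]
  split_ifs with h3
  · simp only [mem_insert, mem_singleton]; tauto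
  · simp only [mem_insert, mem_singleton]
    constructor
    · rintro (h | h | ⟨h, h'⟩)
      · exact Or.inl h
      · exact Or.inr h
      · exact absurd h' h3
    · rintro (h | h)
      · exact Or.inl h
      · exact Or.inr (Or.inl h)

/-- Three-point classes (`41n/3 < p ≤ 41n/2`): the exponent sum is at most `E_x`. -/
theorem sum_three_le_classExp {n p x : ℕ} (h3p : 41 * n < 3 * p) (h2p : 2 * p ≤ 41 * n) (hx : x < p)
    (h3 : x + 2 * p ≤ 41 * n) :
    netExp (bRec n) x + netExp (bRec n) (x + p) + netExp (bRec n) (x + 2 * p) ≤ classExp (bRec n) p x := by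
  refine le_trans (le_of_eq ?_) (classExp_ge_sum _ _ _)
  rw [classSet_bRec_three h3p h2p hx, if_pos h3, sum_insert (by simp; omega), sum_pair (by omega)]; ring

/-- Two-point classes (`41n/3 < p ≤ 41n/2`): the exponent sum is at most `E_x`. -/
theorem sum_two_le_classExp {n p x : ℕ} (h3p : 41 * n < 3 * p) (h2p : 2 * p ≤ 41 * n) (hx : x < p)
    (h3 : ¬ x + 2 * p ≤ 41 * n) :
    netExp (bRec n) x + netExp (bRec n) (x + p) ≤ classExp (bRec n) p x := by
  refine le_trans (le_of_eq ?_) (classExp_ge_sum _ _ _)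
  rw [classSet_bRec_three h3p h2p hx, if_neg h3, sum_pair (by omega)]

/-! ### §2 Class exponents by region -/

section Regions

variable {n p x : ℕ} (hn : 1 ≤ n) (hp : 15 * n < p) (hp' : p < 16 * n) (hx : x < p)

include hn hp hp' hx in
/-- **Region `x < 11n`**: the zero `x` lies below the single pole `x + p ∈ (15n, 27n)` (a third point `x + 2p > 30n` is a
zero): exactly one pole, a TAME class, `ν_x ≥ 0`. -/
theorem R0 (hx11 : x < 11 * n) : classPoleCount (bRec n) p x = 1 ∧ 0 ≤ classNu (bRec n) p x := by
  have h3p : 41 * n < 3 * p := by omega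
  have h2p : 2 * p ≤ 41 * n := by omega
  have ex : netExp (bRec n) x = 1 := by
    rw [netExp_bRec_of_ne n x (by omega), dep7_low hx11]; norm_num
  have exp : netExp (bRec n) (x + p) < 0 := by
    rw [netExp_bRec]; have := four_le_dep7 (n := n) (q := x + p) (by omega) (by omega); split_ifs <;> omega
  by_cases h3 : x + 2 * p ≤ 41 * n
  · have hcs := classSet_bRec_three h3p h2p hx
    rw [if_pos h3] at hcs
    have ex2 : 0 ≤ netExp (bRec n) (x + 2 * p) := by
      rw [netExp_bRec_of_ne n (x + 2 * p) (by omega), dep7_high (by omega)]; norm_num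
    have hcount : classPoleCount (bRec n) p x = 1 := by
      unfold classPoleCount
      rw [hcs, filter_insert, if_neg (by omega), filter_insert, if_pos exp, filter_singleton, if_neg (by omega)]
      simp
    have htm : tameSingle (bRec n) p x = true := by
      rw [tameSingle_iff]
      refine ⟨x + p, by rw [hcs]; simp, exp, Or.inr fun s hs hlt => ?_⟩
      rw [hcs] at hs
      simp only [mem_insert, mem_singleton] at hs
      rcases hs with rfl | rfl | rfl
      · rw [ex]; norm_num
      · omega
      · omega
    refine ⟨hcount, ?_⟩
    unfold classNu
    rw [if_pos ⟨hcount, htm⟩]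
    exact le_max_right _ _
  · have hcs := classSet_bRec_three h3p h2p hx
    rw [if_neg h3] at hcs
    have hcount : classPoleCount (bRec n) p x = 1 := by
      unfold classPoleCount
      rw [hcs, filter_insert, if_neg (by omega), filter_singleton, if_pos exp]
      simp
    have htm : tameSingle (bRec n) p x = true := by
      rw [tameSingle_iff]
      refine ⟨x + p, by rw [hcs]; simp, exp, Or.inr fun s hs hlt => ?_⟩
      rw [hcs] at hs
      simp only [mem_insert, mem_singleton] at hs
      rcases hs with rfl | rfl
      · rw [ex]; norm_num
      · omega
    refine ⟨hcount, ?_⟩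
    unfold classNu
    rw [if_pos ⟨hcount, htm⟩]
    exact le_max_right _ _

include hn hp hp' hx in
/-- **Region `11n ≤ x`** (`x < p < 16n`): two points `x`, `x + p > 26n`; on `x ∈ [(11+j)n, (12+j)n)` the net exponents are
`−j` and `≥ j − 3`, so `E_x ≥ −3`. -/
theorem R15 (hx11 : 11 * n ≤ x) : -3 ≤ classExp (bRec n) p x := by
  have h3 : ¬ x + 2 * p ≤ 41 * n := by omega
  refine le_trans ?_ (sum_two_le_classExp (by omega) (by omega) hx h3)
  have hxp : netExp (bRec n) (x + p) = 1 - (dep7 n (x + p) : ℤ) := netExp_bRec_of_ne n (x + p) (by omega)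
  have hxx : netExp (bRec n) x = 1 - (dep7 n x : ℤ) := netExp_bRec_of_ne n x (by omega)
  by_cases hx12 : x < 12 * n
  · have ex : dep7 n x = 1 := dep7_lower (by norm_num : 1 ≤ 7) (by omega) (by omega)
    have ep : dep7 n (x + p) ≤ 4 := by unfold dep7; split_ifs <;> omega
    rw [hxx, hxp, ex]; omega
  push Not at hx12
  by_cases hx13 : x < 13 * n
  · have ex : dep7 n x = 2 := dep7_lower (by norm_num : 2 ≤ 7) (by omega) (by omega)
    have ep : dep7 n (x + p) ≤ 3 := by unfold dep7; split_ifs <;> omega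
    rw [hxx, hxp, ex]; omega
  push Not at hx13
  by_cases hx14 : x < 14 * n
  · have ex : dep7 n x = 3 := dep7_lower (by norm_num : 3 ≤ 7) (by omega) (by omega)
    have ep : dep7 n (x + p) ≤ 2 := by unfold dep7; split_ifs <;> omega
    rw [hxx, hxp, ex]; omega
  push Not at hx14
  by_cases hx15 : x < 15 * n
  · have ex : dep7 n x = 4 := dep7_lower (by norm_num : 4 ≤ 7) (by omega) (by omega)
    have ep : dep7 n (x + p) ≤ 1 := by unfold dep7; split_ifs <;> omega
    rw [hxx, hxp, ex]; omega
  push Not at hx15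
  have ex : dep7 n x = 5 := dep7_lower (by norm_num : 5 ≤ 7) (by omega) (by omega)
  have ep : dep7 n (x + p) = 0 := dep7_high (by omega)
  rw [hxx, hxp, ex, ep]; norm_num

include hn hp hp' hx in
/-- Every pole class has `ν_x ≥ −3`. -/
theorem classNu_ge16 (_h1 : 1 ≤ classPoleCount (bRec n) p x) : -3 ≤ classNu (bRec n) p x := by
  by_cases hx11 : x < 11 * n
  · exact le_trans (by norm_num) (R0 hn hp hp' hx hx11).2
  · exact le_trans (R15 hn hp hp' hx (by omega)) (classExp_le_classNu _ _ _)

include hn hp hp' hx in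
/-- Every multipole class has `E_x ≥ −3` (below `11n` there are none). -/
theorem classExp_ge16 (h2 : 2 ≤ classPoleCount (bRec n) p x) : -3 ≤ classExp (bRec n) p x := by
  by_cases hx11 : x < 11 * n
  · have := (R0 hn hp hp' hx hx11).1; omega
  · exact R15 hn hp hp' hx (by omega)

end Regions

/-! ### §3 The class bound and the window -/

/-- **`casLB(b(n), p) ≥ −3`** for `n ≥ 1`, `15n < p < 16n`. -/
theorem casLB_ge16 {n p : ℕ} (hn : 1 ≤ n) (hp : 15 * n < p) (hp' : p < 16 * n) : -3 ≤ casLB (bRec n) p := by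
  rcases casLB_ge_or_noPole (bRec n) p (-3) 0 (fun x hx h1 => classNu_ge16 hn hp hp' hx h1) (by norm_num)
      (fun x hx h2 => by linarith [classExp_ge16 hn hp hp' hx h2]) (fun _ => le_rfl) with ⟨h0, -⟩ | h
  · rw [h0]; norm_num
  · linarith

/-- **RECORD WINDOW `(15n, 16n)`, law M by name**: `v_p(Cas₇(b(n))) ≥ −3` for every `n ≥ 1` and prime `15n < p < 16n`
(THEOREM LB `casoratianClassBound_holds` at `casLB ≥ −3`). -/
theorem recordCell1516 (n p : ℕ) (hn : 1 ≤ n) (hpr : p.Prime) (hp : 15 * n < p) (hp' : p < 16 * n)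
    (hne : casoratian (bRec n) 7 ≠ 0) : (-3 : ℤ) ≤ padicValRat p (casoratian (bRec n) 7) := by
  have h5 : 5 ≤ p := by omega
  have hwin : (bRec n 0 + 2 : ℤ) < (p : ℤ) ^ 2 := by
    rw [bRec_zero]
    have hp16 : (16 : ℤ) ≤ p := by exact_mod_cast (show 16 ≤ p by omega)
    have hpn : 15 * (n : ℤ) < p := by exact_mod_cast hp
    nlinarith
  exact (casLB_ge16 hn hp hp').trans (casoratianClassBound_holds (bRec n) 7 p (inPolytope_bRec n) (by norm_num)
    (by norm_num) (inPolytope_shift_bRec n 7 hn (by norm_num) (by norm_num)) hpr h5 hwin hne)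

end Summit.KontsevichZagierPeriods.Zeta5Search.Cell1516
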